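import Summits.QuantumFields.BalabanUV.T4Continuum.Support.KingPairingPlantedLaw
import Summits.QuantumFields.BalabanUV.T4Continuum.Support.ScalarAveragedPropagator

/-!
# T⁴ programme, spine node NE2 (U1a), tier B support row B4.d — KING'S PLANTING ON 0-FORMS: the one-step scalar block averaging
# `Q₀`, the isometric planting `J₀ = √(R^d)·Q₀ᴴ`, the block-mean projector `Π₀ = J₀J₀ᴴ`, and the ONE-STEP BLOCK POINCARÉ
# INEQUALITY ON 0-FORMS `‖(1 − Π₀)X‖ ≤ 2dR·δ` (file 3 of row B4.d)

NE2 formalisation swarm `b2b-balaban-t4-ne2-formalise-*`, seat LEAF PROVER 04, support row B4.d of `t4/formal/NE2/LEAVES.md` («U = 1 scalar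
free-tower laws against King's pairing» — the «free scalar-tower planting/complement defects» datum of row B4.b's abstract law,
CLAIMS.log l.5511 §(2)).  Row B4.c (`Support/ScalarBlockPoincare`, `Support/ScalarAveragedPropagator`) typed the `U = 1` scalar-layer
operator `Δ′ = DeltaPs n M a′ = LapS + a′•Π′` ([Balaban1985BackgroundPropagators] (3.24) p.394 at `U = 1`) with its coercivity `γ′` and
`‖∂_νG′‖ ≤ √(γ′⁻¹)`.  The free-tower laws compare `G′ = Δ′⁻¹` at ADJACENT spacings `η = 1/N` and `η/R`; this file supplies the pairing
(this file: the pairing and the one-step block Poincaré inequality; the companion `Support/ScalarPlantingDefect` then gives the exact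
intertwining of the unit-block mass and the complement defect), on the 0-form tori `Tor (fine N M)` ⊂ `Tor (fine (R·N) M)` (no casts:
`fine (R·N) M` is the tower's next level):

 * §1 the component embedding `emb μ₀ : 0-forms → μ₀-component of 1-forms` (isometry; intertwines the shifts) — the device by which the
   VECTOR-index block tools of the route (`BalabanBlockPoincare.Pi`, `opNorm_one_sub_Pi_mul_le`, King's `Qavg`) are read on 0-forms;
 * §2 **`Qavg0 N R M`** (`Q₀(y, x) = R^{−d}·[par x = y]`), **`JK0 = √(R^d)·Q₀ᴴ`** (`J₀ᴴJ₀ = 1`, `‖Q₀‖² ≤ R^{−d}`, `‖J₀‖ ≤ 1`, pairing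
   `√(R^d)·Q₀J₀ = 1` EXACT), **`Pi0 = J₀J₀ᴴ`**; `Qavg · emb = emb · Qavg0` (King's averaging is `Q₀` componentwise);
 * §3 **THE ONE-STEP BLOCK POINCARÉ INEQUALITY ON 0-FORMS** `‖(1 − Π₀)X‖ ≤ 2dR·δ` from `‖(S_ν − 1)X‖ ≤ δ` (transfer of the vector lemma
   through `emb`, `d ≥ 1`);
 * (companion file `Support/ScalarPlantingDefect`: the exact intertwining `PiS (R·N) M = JK0 · PiS N M · JK0ᴴ` of the unit-block mass,
   the `A + JBJᴴ` form of `DeltaPs (R·N) M a′`, the complement defect `‖G′_{RN}(1 − J₀J₀ᴴ)‖ ≤ 2d·√(γ′⁻¹)/N`, tower-level names).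

HONEST FRAMING (T4-DAG p. 1).  `U = 1`, finite torus, scalar (0-form) layer, operator norm; exact lattice bookkeeping + one inequality;
statements / constants OURS ([folklore]); a SUPPORT input of row B4.b, NOT B4, NOT [Balaban1985BackgroundPropagators] (3.23)–(3.26) as
printed; NE2 NOT proved; NOT infinite volume / mass gap / Clay / summit progress; spine 0/9 unchanged.  HONEST DEPENDENCY: continuum YM on
T⁴ ⇐ BetaPertH ∧ nine spine estimates (0/9 proved); BetaPertH ⇐ (D1) ∧ (D4) ∧ CAP+tail; G-an2-4 gates asym, D1 and NE2/3/4.  ABSOLUTE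
RULE kept; no `sorry`.
-/

noncomputable section

open scoped BigOperators ComplexConjugate Matrix Matrix.Norms.L2Operator

namespace Summit.QuantumFields.BalabanUV.T4Continuum.ScalarBlockPlanting

open Literature.MathematicalPhysics.QuantumFieldTheory.Balaban1983to89.B5Prop11Plancherel
open Literature.MathematicalPhysics.QuantumFieldTheory.Balaban1983to89.B5Action121 (shiftS sdiff LapS)
open Literature.MathematicalPhysics.QuantumFieldTheory.Balaban1983to89.B5Block118 (QsOp bpt)
open Literature.MathematicalPhysics.QuantumFieldTheory.Balaban1983to89.B5Blocks16 (blockOf bpt_val bpt_bijective)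
open Literature.MathematicalPhysics.QuantumFieldTheory.Balaban1983to89.B5G183RateOp (opNorm_le_of_schur)
open Literature.MathematicalPhysics.QuantumFieldTheory.Balaban1983to89.B5G183RateTorus (cpt)
open Literature.MathematicalPhysics.QuantumFieldTheory.Balaban1983to89.B5G183RateTorusW (off Qavg)
open Literature.MathematicalPhysics.QuantumFieldTheory.Balaban1983to89.B5G183RateUnitTower (lev lev_neZero)
open Summit.QuantumFields.BalabanUV.T4Continuum
open Summit.QuantumFields.BalabanUV.T4Continuum.BalabanAveragedTowerUnit (idx lev_succ' one_le_lev' cast_lev')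
open Summit.QuantumFields.BalabanUV.T4Continuum.BalabanAveragedTowerModes (par rem val_par par_cpt_add_off rem_cpt_add_off
  cpt_par_add_off_rem)
open Summit.QuantumFields.BalabanUV.T4Continuum.BalabanBlockPoincare (Pi tileEquiv opNorm_one_sub_Pi_mul_le Qavg_conjTranspose_mul_apply)
open Summit.QuantumFields.BalabanUV.T4Continuum.KingPairingPlantedLaw
open Summit.QuantumFields.BalabanUV.T4Continuum.ScalarBlockPoincare (PiS)
open Summit.QuantumFields.BalabanUV.T4Continuum.ScalarAveragedPropagator (DeltaPs gammaPs Gps gammaPs_pos Gps_isHermitian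
  opNorm_sdiff_mul_Gps_le)

variable {d : ℕ}

/-! ## §1 The component embedding of 0-forms into vector fields -/

section Emb

variable (Nf : Fin d → ℕ) [hNf : ∀ μ, NeZero (Nf μ)] (μ₀ : Fin d)

/-- the COMPONENT EMBEDDING `(emb μ₀ f)(x, μ) = [μ = μ₀]·f(x)`. [folklore] -/
def emb : Matrix (Tor Nf × Fin d) (Tor Nf) ℂ := fun i y => if i = (y, μ₀) then 1 else 0

/-- rows of `emb · X₀`. [folklore] -/
theorem emb_mul_apply {β : Type*} (X₀ : Matrix (Tor Nf) β ℂ) (i : Tor Nf × Fin d) (b : β) :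
    (emb Nf μ₀ * X₀) i b = if i.2 = μ₀ then X₀ i.1 b else 0 := by
  simp only [Matrix.mul_apply, emb, ite_mul, one_mul, zero_mul]
  by_cases h : i.2 = μ₀
  · rw [if_pos h, Finset.sum_eq_single i.1]
    · have hi : i = (i.1, μ₀) := Prod.ext rfl h
      rw [if_pos hi]
    · intro y _ hy; rw [if_neg]; intro hi; exact hy (by rw [hi])
    · intro hh; exact absurd (Finset.mem_univ _) hh
  · rw [if_neg h]
    refine Finset.sum_eq_zero fun y _ => ?_
    rw [if_neg]; intro hi; exact h (by rw [hi])

/-- rows of `embᴴ · X`: the `μ₀`-component. [folklore] -/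
theorem embH_mul_apply {β : Type*} (X : Matrix (Tor Nf × Fin d) β ℂ) (y : Tor Nf) (b : β) :
    ((emb Nf μ₀)ᴴ * X) y b = X (y, μ₀) b := by
  simp only [Matrix.mul_apply, Matrix.conjTranspose_apply, emb, apply_ite star, star_one, star_zero, ite_mul, one_mul, zero_mul]
  rw [Finset.sum_ite_eq' Finset.univ (y, μ₀)]
  simp

/-- columns of `X · emb`: `(X emb)(i, y) = X(i, (y, μ₀))`. [folklore] -/
theorem mul_emb_apply {α : Type*} (X : Matrix α (Tor Nf × Fin d) ℂ) (i : α) (y : Tor Nf) :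
    (X * emb Nf μ₀) i y = X i (y, μ₀) := by
  simp only [Matrix.mul_apply, emb, mul_ite, mul_one, mul_zero]
  rw [Finset.sum_ite_eq' Finset.univ (y, μ₀)]
  simp

/-- `embᴴ emb = 1` (isometry). [folklore] -/
theorem embH_mul_emb : (emb Nf μ₀)ᴴ * emb Nf μ₀ = 1 := by
  ext y y'
  rw [embH_mul_apply, emb, Matrix.one_apply]
  by_cases h : y = y'
  · subst h; simp
  · rw [if_neg (fun hh => h (Prod.ext_iff.mp hh).1), if_neg h]

/-- `‖emb‖ ≤ 1`. [folklore] -/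
theorem opNorm_emb_le : ‖emb Nf μ₀‖ ≤ 1 := by
  have h : ‖emb Nf μ₀‖ ^ 2 ≤ 1 := by
    rw [sq, ← Matrix.l2_opNorm_conjTranspose_mul_self, embH_mul_emb]
    exact CovariantAveragingTower.opNorm_one_le (ι := fun _ => Tor Nf) 0
  nlinarith [norm_nonneg (emb Nf μ₀)]

/-- `‖embᴴ‖ ≤ 1`. [folklore] -/
theorem opNorm_embH_le : ‖(emb Nf μ₀)ᴴ‖ ≤ 1 := by
  rw [Matrix.l2_opNorm_conjTranspose]; exact opNorm_emb_le Nf μ₀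

/-- `‖embᴴ Y emb‖ ≤ ‖Y‖`. [folklore] -/
theorem opNorm_embH_mul_mul_emb_le (Y : Matrix (Tor Nf × Fin d) (Tor Nf × Fin d) ℂ) :
    ‖(emb Nf μ₀)ᴴ * Y * emb Nf μ₀‖ ≤ ‖Y‖ := by
  calc ‖(emb Nf μ₀)ᴴ * Y * emb Nf μ₀‖ ≤ ‖(emb Nf μ₀)ᴴ‖ * ‖Y‖ * ‖emb Nf μ₀‖ :=
        (Matrix.l2_opNorm_mul _ _).trans (mul_le_mul_of_nonneg_right (Matrix.l2_opNorm_mul _ _) (norm_nonneg _))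
    _ ≤ 1 * ‖Y‖ * 1 := mul_le_mul (mul_le_mul_of_nonneg_right (opNorm_embH_le Nf μ₀) (norm_nonneg _)) (opNorm_emb_le Nf μ₀)
        (norm_nonneg _) (by positivity)
    _ = ‖Y‖ := by ring

/-- `‖emb X₀ embᴴ‖ ≤ ‖X₀‖`. [folklore] -/
theorem opNorm_emb_mul_mul_embH_le (X₀ : Matrix (Tor Nf) (Tor Nf) ℂ) :
    ‖emb Nf μ₀ * X₀ * (emb Nf μ₀)ᴴ‖ ≤ ‖X₀‖ := by
  calc ‖emb Nf μ₀ * X₀ * (emb Nf μ₀)ᴴ‖ ≤ ‖emb Nf μ₀‖ * ‖X₀‖ * ‖(emb Nf μ₀)ᴴ‖ :=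
        (Matrix.l2_opNorm_mul _ _).trans (mul_le_mul_of_nonneg_right (Matrix.l2_opNorm_mul _ _) (norm_nonneg _))
    _ ≤ 1 * ‖X₀‖ * 1 := mul_le_mul (mul_le_mul_of_nonneg_right (opNorm_emb_le Nf μ₀) (norm_nonneg _)) (opNorm_embH_le Nf μ₀)
        (norm_nonneg _) (by positivity)
    _ = ‖X₀‖ := by ring

/-- **the shifts intertwine**: `S_ν · emb = emb · S⁰_ν`. [folklore] -/
theorem shiftM_mul_emb (ν : Fin d) : shiftM Nf ν * emb Nf μ₀ = emb Nf μ₀ * shiftS Nf ν := by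
  ext i y
  rw [BalabanBlockPoincare.shiftM_eq_transl, BalabanBlockPoincare.transl_mul_apply, emb_mul_apply]
  simp only [emb, shiftS]
  by_cases h : i.2 = μ₀
  · rw [if_pos h]
    by_cases hy : y = i.1 + unitVec Nf ν
    · rw [if_pos hy, if_pos (Prod.ext hy.symm h)]
    · rw [if_neg hy, if_neg (fun hh => hy ((Prod.ext_iff.mp hh).1).symm)]
  · rw [if_neg h, if_neg (fun hh => h (Prod.ext_iff.mp hh).2)]

end Emb

/-! ## §2 The one-step block averaging of 0-forms and King's planting -/

section TwoLevel

variable (N R : ℕ) [NeZero N] [NeZero R] (M : Fin d → ℕ) [hM : ∀ μ, NeZero (M μ)]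

/-- **KING's one-step BLOCK AVERAGING OF 0-FORMS** from the `η/R`-lattice to the `η`-lattice: `Q₀(y, x) = R^{−d}·[par x = y]` (the
`R^d` fine sites `R·y + j`, `j ∈ {0,…,R−1}^d`, of the block of `y`). [cite: King1986, (2.10) p.653] [folklore] -/
def Qavg0 : Matrix (Tor (fine N M)) (Tor (fine (R * N) M)) ℂ := fun y x => if par N R M x = y then (((R : ℂ) ^ d)⁻¹) else 0

/-- **KING's PLANTING OF 0-FORMS** `J₀ = √(R^d)·Q₀ᴴ` (piecewise-constant extension, isometrically normalised).
[cite: King1986, p.664 (convention before Prop. 3.8)] [folklore] -/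
def JK0 : Matrix (Tor (fine (R * N) M)) (Tor (fine N M)) ℂ := (((Real.sqrt ((R : ℝ) ^ d)) : ℝ) : ℂ) • (Qavg0 N R M)ᴴ

/-- the one-step BLOCK-MEAN PROJECTOR on 0-forms `Π₀ = R^d·Q₀ᴴQ₀`. [folklore] -/
def Pi0 : Matrix (Tor (fine (R * N) M)) (Tor (fine (R * N) M)) ℂ := ((R : ℂ) ^ d) • ((Qavg0 N R M)ᴴ * Qavg0 N R M)

omit [NeZero N] [NeZero R] hM in
/-- the entries of `Q₀` are real. [folklore] -/
theorem star_Qavg0_apply (y : Tor (fine N M)) (x : Tor (fine (R * N) M)) : star (Qavg0 N R M y x) = Qavg0 N R M y x := by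
  simp only [Qavg0, apply_ite star, star_inv₀, star_pow, star_natCast, star_zero]

omit [NeZero R] in
/-- rows of `Q₀ᴴ Y`: `(Q₀ᴴY)(x) = R^{−d}·Y(par x)`. [folklore] -/
theorem Qavg0_conjTranspose_mul_apply {β : Type*} (Y : Matrix (Tor (fine N M)) β ℂ) (x : Tor (fine (R * N) M)) (b : β) :
    ((Qavg0 N R M)ᴴ * Y) x b = ((R : ℂ) ^ d)⁻¹ * Y (par N R M x) b := by
  simp only [Matrix.mul_apply, Matrix.conjTranspose_apply]
  simp_rw [star_Qavg0_apply]
  simp only [Qavg0, ite_mul, zero_mul]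
  rw [Finset.sum_ite_eq Finset.univ (par N R M x)]
  simp

/-- sums over the fine torus, tiled by blocks. [folklore] -/
theorem sum_fine_eq_sum_tile (g : Tor (fine (R * N) M) → ℂ) :
    ∑ x, g x = ∑ y : Tor (fine N M), ∑ j : Fin d → Fin R, g (cpt N R M y + off N R M j) := by
  rw [← Fintype.sum_equiv (tileEquiv N R M) (fun p => g (tileEquiv N R M p)) g (fun _ => rfl), Fintype.sum_prod_type]
  rfl

/-- rows of `Q₀ X`: block averages `(Q₀X)(y) = R^{−d}·Σ_j X(R·y + j)`. [cite: King1986, (2.10) p.653] [folklore] -/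
theorem Qavg0_mul_apply {β : Type*} (X : Matrix (Tor (fine (R * N) M)) β ℂ) (y : Tor (fine N M)) (b : β) :
    (Qavg0 N R M * X) y b = ((R : ℂ) ^ d)⁻¹ * ∑ j : Fin d → Fin R, X (cpt N R M y + off N R M j) b := by
  rw [Matrix.mul_apply, sum_fine_eq_sum_tile N R M, Finset.mul_sum]
  rw [Finset.sum_eq_single y]
  · refine Finset.sum_congr rfl fun j _ => ?_
    rw [Qavg0, par_cpt_add_off, if_pos rfl]
  · intro y' _ hy'
    refine Finset.sum_eq_zero fun j _ => ?_
    rw [Qavg0, par_cpt_add_off, if_neg hy', zero_mul]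
  · intro hh; exact absurd (Finset.mem_univ _) hh

/-- **`Q₀Q₀ᴴ = R^{−d}·1`** (the blocks tile the fine torus, `R^d` sites each). [folklore] -/
theorem Qavg0_mul_conjTranspose : Qavg0 N R M * (Qavg0 N R M)ᴴ = ((R : ℂ) ^ d)⁻¹ • (1 : Matrix (Tor (fine N M)) (Tor (fine N M)) ℂ) := by
  have hRc : ((R : ℂ) ^ d) ≠ 0 := pow_ne_zero _ (by exact_mod_cast NeZero.ne R)
  ext y y'
  rw [Qavg0_mul_apply, Matrix.smul_apply, smul_eq_mul]
  simp_rw [Matrix.conjTranspose_apply, star_Qavg0_apply]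
  simp only [Qavg0, par_cpt_add_off]
  by_cases h : y = y'
  · subst h
    simp only [if_true, Finset.sum_const, Finset.card_univ, Fintype.card_fun, Fintype.card_fin, nsmul_eq_mul, Matrix.one_apply_eq,
      mul_one]
    push_cast
    field_simp
  · rw [Matrix.one_apply_ne h, mul_zero]
    simp [h]

omit [NeZero R] in
/-- `√(R^d)` facts. [folklore] -/
private theorem sqrtR : star ((((Real.sqrt ((R : ℝ) ^ d)) : ℝ) : ℂ)) = (((Real.sqrt ((R : ℝ) ^ d)) : ℝ) : ℂ) ∧
    ((((Real.sqrt ((R : ℝ) ^ d)) : ℝ) : ℂ)) * (((Real.sqrt ((R : ℝ) ^ d)) : ℝ) : ℂ) = (R : ℂ) ^ d := sqrt_facts (d := d) R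

/-- **`J₀ᴴJ₀ = 1`**. [folklore] -/
theorem JK0_conjTranspose_mul_JK0 : (JK0 N R M)ᴴ * JK0 N R M = 1 := by
  have hRc : ((R : ℂ) ^ d) ≠ 0 := pow_ne_zero _ (by exact_mod_cast NeZero.ne R)
  obtain ⟨hs, hss⟩ := sqrtR (d := d) R
  rw [JK0, Matrix.conjTranspose_smul, Matrix.conjTranspose_conjTranspose, hs, Matrix.smul_mul, Matrix.mul_smul, smul_smul, hss,
    Qavg0_mul_conjTranspose, smul_smul, mul_inv_cancel₀ hRc, one_smul]

omit [NeZero R] in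
/-- `J₀J₀ᴴ = Π₀`. [folklore] -/
theorem JK0_mul_conjTranspose : JK0 N R M * (JK0 N R M)ᴴ = Pi0 N R M := by
  obtain ⟨hs, hss⟩ := sqrtR (d := d) R
  rw [JK0, Matrix.conjTranspose_smul, Matrix.conjTranspose_conjTranspose, hs, Matrix.smul_mul, Matrix.mul_smul, smul_smul, hss]
  rfl

/-- `‖Q₀‖² ≤ R^{−d}`. [folklore] -/
theorem opNorm_Qavg0_sq_le : ‖Qavg0 N R M‖ ^ 2 ≤ ((R : ℝ) ^ d)⁻¹ := by
  have hRr : (0 : ℝ) < (R : ℝ) ^ d := pow_pos (by exact_mod_cast Nat.pos_of_ne_zero (NeZero.ne R)) d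
  rw [sq, ← Matrix.l2_opNorm_conjTranspose (Qavg0 N R M), ← Matrix.l2_opNorm_conjTranspose_mul_self, Matrix.conjTranspose_conjTranspose,
    Qavg0_mul_conjTranspose, norm_smul, norm_inv, norm_pow, Complex.norm_natCast]
  calc ((R : ℝ) ^ d)⁻¹ * ‖(1 : Matrix (Tor (fine N M)) (Tor (fine N M)) ℂ)‖ ≤ ((R : ℝ) ^ d)⁻¹ * 1 :=
        mul_le_mul_of_nonneg_left (CovariantAveragingTower.opNorm_one_le (ι := fun _ => Tor (fine N M)) 0) (inv_nonneg.mpr hRr.le)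
    _ = ((R : ℝ) ^ d)⁻¹ := mul_one _

/-- `‖J₀‖ ≤ 1`. [folklore] -/
theorem opNorm_JK0_le : ‖JK0 N R M‖ ≤ 1 := by
  have h : ‖JK0 N R M‖ ^ 2 ≤ 1 := by
    rw [sq, ← Matrix.l2_opNorm_conjTranspose_mul_self, JK0_conjTranspose_mul_JK0]
    exact CovariantAveragingTower.opNorm_one_le (ι := fun _ => Tor (fine N M)) 0
  nlinarith [norm_nonneg (JK0 N R M)]

/-- **the pairing is EXACT**: `√(R^d)·Q₀J₀ = 1 + 0`. [cite: King1986, (2.10) p.653] [folklore] -/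
theorem sqrt_smul_Qavg0_mul_JK0 : ((((Real.sqrt ((R : ℝ) ^ d)) : ℝ) : ℂ)) • (Qavg0 N R M * JK0 N R M) = 1 + 0 := by
  have hRc : ((R : ℂ) ^ d) ≠ 0 := pow_ne_zero _ (by exact_mod_cast NeZero.ne R)
  obtain ⟨-, hss⟩ := sqrtR (d := d) R
  rw [add_zero, JK0, Matrix.mul_smul, smul_smul, hss, Qavg0_mul_conjTranspose, smul_smul, mul_inv_cancel₀ hRc, one_smul]

omit [NeZero R] in
/-- `Π₀` is Hermitian. [folklore] -/
theorem Pi0_conjTranspose : (Pi0 N R M)ᴴ = Pi0 N R M := by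
  rw [← JK0_mul_conjTranspose, Matrix.conjTranspose_mul, Matrix.conjTranspose_conjTranspose]

/-- King's VECTOR averaging is `Q₀` componentwise: its entries. [folklore] -/
theorem Qavg_apply (i : Tor (fine N M) × Fin d) (x : Tor (fine (R * N) M) × Fin d) :
    Qavg N R M i x = if (par N R M x.1, x.2) = i then ((R : ℂ) ^ d)⁻¹ else 0 := by
  have h := Qavg_conjTranspose_mul_apply N R M (1 : Matrix (Tor (fine N M) × Fin d) (Tor (fine N M) × Fin d) ℂ) x i
  rw [Matrix.mul_one, Matrix.conjTranspose_apply, BalabanAveragedTowerModes.star_Qavg_apply, Matrix.one_apply] at h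
  rw [h]; split_ifs <;> simp

/-- **`Qavg · emb = emb · Q₀`** (same component `μ₀` on both lattices). [folklore] -/
theorem Qavg_mul_emb (μ₀ : Fin d) : Qavg N R M * emb (fine (R * N) M) μ₀ = emb (fine N M) μ₀ * Qavg0 N R M := by
  ext i x₀
  rw [mul_emb_apply, emb_mul_apply, Qavg_apply]
  simp only [Qavg0]
  by_cases h : i.2 = μ₀
  · rw [if_pos h]
    by_cases hp : par N R M x₀ = i.1
    · rw [if_pos hp, if_pos (Prod.ext hp h.symm)]
    · rw [if_neg hp, if_neg (fun hh => hp (Prod.ext_iff.mp hh).1)]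
  · rw [if_neg h, if_neg (fun hh => h ((Prod.ext_iff.mp hh).2).symm)]

/-- **`Qavgᴴ · emb = emb · Q₀ᴴ`**. [folklore] -/
theorem QavgH_mul_emb (μ₀ : Fin d) : (Qavg N R M)ᴴ * emb (fine N M) μ₀ = emb (fine (R * N) M) μ₀ * (Qavg0 N R M)ᴴ := by
  ext x y₀
  rw [mul_emb_apply, emb_mul_apply, Matrix.conjTranspose_apply, BalabanAveragedTowerModes.star_Qavg_apply, Qavg_apply,
    Matrix.conjTranspose_apply, star_Qavg0_apply]
  simp only [Qavg0]
  by_cases h : x.2 = μ₀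
  · rw [if_pos h]
    by_cases hp : par N R M x.1 = y₀
    · rw [if_pos (Prod.ext hp h), if_pos hp]
    · rw [if_neg (fun hh => hp (Prod.ext_iff.mp hh).1), if_neg hp]
  · rw [if_neg (fun hh => h (Prod.ext_iff.mp hh).2), if_neg h]

/-- **`Π · emb = emb · Π₀`** (the block-mean projectors intertwine with the component embedding). [folklore] -/
theorem Pi_mul_emb (μ₀ : Fin d) : Pi N R M * emb (fine (R * N) M) μ₀ = emb (fine (R * N) M) μ₀ * Pi0 N R M := by
  rw [Pi, Pi0, Matrix.smul_mul, Matrix.mul_smul, Matrix.mul_assoc, Qavg_mul_emb, ← Matrix.mul_assoc, QavgH_mul_emb, Matrix.mul_assoc]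

/-! ## §3 The one-step block Poincaré inequality on 0-forms -/

/-- **THE BLOCK POINCARÉ INEQUALITY ON 0-FORMS** (`d ≥ 1`): `‖(1 − Π₀)X‖ ≤ 2dR·δ` whenever `‖(S_ν − 1)X‖ ≤ δ` for every axis — transferred
from `BalabanBlockPoincare.opNorm_one_sub_Pi_mul_le` through the component embedding. [folklore] -/
theorem opNorm_one_sub_Pi0_mul_le (hd : 0 < d) (X : Matrix (Tor (fine (R * N) M)) (Tor (fine (R * N) M)) ℂ) {δ : ℝ} (hδ : 0 ≤ δ)
    (hX : ∀ ν, ‖(shiftS (fine (R * N) M) ν - 1) * X‖ ≤ δ) : ‖(1 - Pi0 N R M) * X‖ ≤ 2 * (d * R * δ) := by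
  set μ₀ : Fin d := ⟨0, hd⟩
  set E := emb (fine (R * N) M) μ₀ with hE
  have hEE : Eᴴ * E = 1 := embH_mul_emb _ μ₀
  -- the padded vector-index matrix
  set Y : Matrix (Tor (fine (R * N) M) × Fin d) (Tor (fine (R * N) M) × Fin d) ℂ := E * X * Eᴴ with hY
  have hYS : ∀ ν, ‖(shiftM (fine (R * N) M) ν - 1) * Y‖ ≤ δ := by
    intro ν
    have e1 : shiftM (fine (R * N) M) ν * Y = E * (shiftS (fine (R * N) M) ν * X) * Eᴴ := by
      calc shiftM (fine (R * N) M) ν * Y = (shiftM (fine (R * N) M) ν * E) * X * Eᴴ := by simp only [hY, Matrix.mul_assoc]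
        _ = (E * shiftS (fine (R * N) M) ν) * X * Eᴴ := by rw [hE, shiftM_mul_emb]
        _ = E * (shiftS (fine (R * N) M) ν * X) * Eᴴ := by simp only [Matrix.mul_assoc]
    have e : (shiftM (fine (R * N) M) ν - 1) * Y = E * ((shiftS (fine (R * N) M) ν - 1) * X) * Eᴴ := by
      rw [Matrix.sub_mul, Matrix.one_mul, e1, Matrix.sub_mul, Matrix.one_mul, Matrix.mul_sub, Matrix.sub_mul, hY]
    rw [e]
    exact (opNorm_emb_mul_mul_embH_le _ μ₀ _).trans (hX ν)
  have hP := opNorm_one_sub_Pi_mul_le N R M Y hδ hYS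
  -- read it back on the `μ₀` component
  have e3 : Eᴴ * Y * E = X := by
    calc Eᴴ * Y * E = (Eᴴ * E) * X * (Eᴴ * E) := by simp only [hY, Matrix.mul_assoc]
      _ = X := by rw [hEE, Matrix.one_mul, Matrix.mul_one]
  have e4 : Eᴴ * (Pi N R M * Y) * E = Pi0 N R M * X := by
    calc Eᴴ * (Pi N R M * Y) * E = Eᴴ * (Pi N R M * E) * X * (Eᴴ * E) := by simp only [hY, Matrix.mul_assoc]
      _ = Eᴴ * (E * Pi0 N R M) * X * (Eᴴ * E) := by rw [hE, Pi_mul_emb]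
      _ = (Eᴴ * E) * Pi0 N R M * X * (Eᴴ * E) := by simp only [Matrix.mul_assoc]
      _ = Pi0 N R M * X := by rw [hEE, Matrix.one_mul, Matrix.mul_one]
  have e2 : (1 - Pi0 N R M) * X = Eᴴ * ((1 - Pi N R M) * Y) * E := by
    rw [Matrix.sub_mul (1 : Matrix _ _ ℂ) (Pi0 N R M) X, Matrix.one_mul, Matrix.sub_mul (1 : Matrix _ _ ℂ) (Pi N R M) Y,
      Matrix.one_mul, Matrix.mul_sub, Matrix.sub_mul, e3, e4]
  rw [e2]
  exact (opNorm_embH_mul_mul_emb_le _ μ₀ _).trans hP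

end TwoLevel

end Summit.QuantumFields.BalabanUV.T4Continuum.ScalarBlockPlanting

end
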